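import Mathlib
import Summits.Ventures.PercRepro2.Defs
import Summits.Ventures.PercRepro2.Independence
import Summits.Ventures.PercRepro2.Harris
import Summits.Ventures.PercRepro2.Graph
import Summits.Ventures.PercRepro2.Exploration
import Summits.Ventures.PercRepro2.Events
import Summits.Ventures.PercRepro2.FourFunctions
import Summits.Ventures.PercRepro2.Induced
import Summits.Ventures.PercRepro2.Frontier
import Summits.Ventures.PercRepro2.ObsIndependence
import Summits.Ventures.PercRepro2.BHK
import Summits.Ventures.PercRepro2.BHKEvents
import Summits.Ventures.PercRepro2.SideAgreement
import Summits.Ventures.PercRepro2.VdBKahn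
import Summits.Ventures.PercRepro2.BHKAvoid
import Summits.Ventures.PercRepro2.R2PrimeThreeReduction
import Summits.Ventures.PercRepro2.YBridge
import Summits.Ventures.PercRepro2.Yu1Functionals
import Summits.Ventures.PercRepro2.Yu1Events
import Summits.Ventures.PercRepro2.Yu1
import Summits.Ventures.PercRepro2.LBSplit
import Summits.Ventures.PercRepro2.YDelta
import Summits.Ventures.PercRepro2.SD
import Summits.Ventures.PercRepro2.Threshold
import Summits.Ventures.PercRepro2.Lambda
import Summits.Ventures.PercRepro2.LambdaTau
import Summits.Ventures.PercRepro2.LambdaSlack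
import Summits.Ventures.PercRepro2.HF2
import Summits.Ventures.PercRepro2.Yu2
import Summits.Ventures.PercRepro2.N0
import Summits.Ventures.PercRepro2.Y
import Summits.Ventures.PercRepro2.YDeltaTools
import Summits.Ventures.PercRepro2.ZDelta
import Summits.Ventures.PercRepro2.ZExpand
import Summits.Ventures.PercRepro2.ISplit
import Summits.Ventures.PercRepro2.MRl
import Summits.Ventures.PercRepro2.ZOloc
import Summits.Ventures.PercRepro2.SideBridge
import Summits.Ventures.PercRepro2.HCov

/-!
# (AVG-CHORD): vocabulary and the base lemma (blind cell PercRepro2, typer-1;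
mine-a g1 `MINEA-LOCALSUPER.md` §10–§11, INBOX 2026-08-23T08:2xZ (iii); lead ASSIGNMENTS v11.7 (4))

In the weight formalism "revealing an edge" is pinning its weight to `0` or `1`:

* `oneConfig p` = the configuration of the weight-`1` edges, `frac p` = the fractional edges,
  `rootSet` = `S_l ∪ S_h` (the clusters of `a₁, a₂` in the weight-`1` subgraph),
  `rootEdges p` = the fractional edges touching `S_l ∪ S_h`, `Gloc = Gc / (D · P(Q))`
  (Lean's `x / 0 = 0` gives the degenerate convention);
* **`AvgChord p`** (row 2′AVGCHORD at the weight vector `p`): when `rootEdges p ≠ ∅`,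
  `|rootEdges| · Gloc p ≥ Σ_{e ∈ rootEdges} [p_e · Gloc p[e↦1] + (1 − p_e) · Gloc p[e↦0]]`;
* **`Gc_eq_zero_of_rootEdges_empty`** (the base lemma): with no fractional edge at the root
  clusters, both root clusters are deterministic on the support of `p`, every event of `Gc` is
  a `0/1` constant, and `Gc` vanishes identically (a Boolean identity in seven atoms);
* the induction (`Gloc_nonneg_of_avgChord`, `HCov_of_avgChord`, `HCov_all_of_avgChord_all`) is in
  `Chord.lean`.

Census (mine-a, adversarial weights): root level 0 / 3,104 (n = 5 full) + 0 / 580 (n = 6, m ≤ 11)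
+ 0 / 264 (n = 7); residual instances 0 / 4,869 nodes; random pinning patterns 0 / 601.
-/

namespace Summit.Ventures.PercRepro2

open UnionCluster CovForm

namespace Chord

open scoped Classical

section Defs

variable {V : Type*} {E : Type*} [Fintype E] [DecidableEq E] {R : Type*} [Field R]
  [LinearOrder R]

/-- The configuration of the weight-`1` edges. -/
noncomputable def oneConfig (p : E → R) : Config E := fun e => decide (p e = 1)

/-- The fractional edges `{e ∣ p e ≠ 0, p e ≠ 1}`. -/
noncomputable def frac (p : E → R) : Finset E := Finset.univ.filter fun e => p e ≠ 0 ∧ p e ≠ 1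

/-- `S_l ∪ S_h`: the clusters of the two roots in the weight-`1` subgraph. -/
noncomputable def rootSet (p : E → R) (ends : E → Sym2 V) (a₁ a₂ : V) : Set V :=
  cluster ends (oneConfig p) a₁ ∪ cluster ends (oneConfig p) a₂

/-- The root edges: fractional edges touching `S_l ∪ S_h`. -/
noncomputable def rootEdges (p : E → R) (ends : E → Sym2 V) (a₁ a₂ : V) : Finset E :=
  (frac p).filter fun e => e ∈ touches ends (rootSet p ends a₁ a₂)

/-- `Gloc = Gc / (D · P(Q))` (`= G` when `D · P(Q) ≠ 0`, `0` otherwise). -/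
noncomputable def Gloc (p : E → R) (ends : E → Sym2 V) (o a₁ a₂ a₃ b : V) : R :=
  Gc p ends o a₁ a₂ a₃ b /
    (prob p (PDEvent ends a₁ a₂ a₃) * prob p (avoidAll ends a₂ {a₁}))

/-- **(AVG-CHORD)** at the weight vector `p` (mine-a §10): if some root edge is fractional,
`|rootEdges| · Gloc p ≥ Σ_{e ∈ rootEdges} [p_e · Gloc p[e↦1] + (1 − p_e) · Gloc p[e↦0]]`. -/
def AvgChord (p : E → R) (ends : E → Sym2 V) (o a₁ a₂ a₃ b : V) : Prop :=
  (rootEdges p ends a₁ a₂).Nonempty →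
    ∑ e ∈ rootEdges p ends a₁ a₂,
        (p e * Gloc (Function.update p e 1) ends o a₁ a₂ a₃ b +
          (1 - p e) * Gloc (Function.update p e 0) ends o a₁ a₂ a₃ b) ≤
      (rootEdges p ends a₁ a₂).card * Gloc p ends o a₁ a₂ a₃ b

end Defs

section Closure

variable (R : Type*) [Field R] [LinearOrder R] [IsStrictOrderedRing R]

/-- Row 2′AVGCHORD over all finite graphs, admissible weights and markings. -/
def AvgChord_all : Prop :=
  ∀ (V E : Type) [Fintype V] [DecidableEq V] [Fintype E] [DecidableEq E]
    (ends : E → Sym2 V) (p : E → R), IsProbVec p →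
    ∀ o a₁ a₂ a₃ b : V, a₁ ≠ a₂ → a₁ ≠ a₃ → a₂ ≠ a₃ → o ≠ a₁ → o ≠ a₂ → o ≠ a₃ → o ≠ b →
      b ≠ a₁ → b ≠ a₂ → b ≠ a₃ → AvgChord p ends o a₁ a₂ a₃ b

end Closure

/-! ## Fractional edges under pinning -/

section Frac

variable {V : Type*} {E : Type*} [Fintype E] [DecidableEq E] {R : Type*} [Field R]
  [LinearOrder R]

omit [DecidableEq E] in
/-- Membership in `frac`. -/
lemma mem_frac {p : E → R} {e : E} : e ∈ frac p ↔ p e ≠ 0 ∧ p e ≠ 1 := by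
  simp [frac]

/-- Pinning a fractional edge to `1` removes it from the fractional edges. -/
lemma frac_update_one {p : E → R} {e : E} (he : e ∈ frac p) :
    frac (Function.update p e 1) = (frac p).erase e := by
  ext e'
  by_cases h : e' = e
  · subst h
    simp [mem_frac]
  · simp [mem_frac, h]

/-- Pinning a fractional edge to `0` removes it from the fractional edges. -/
lemma frac_update_zero {p : E → R} {e : E} (he : e ∈ frac p) :
    frac (Function.update p e 0) = (frac p).erase e := by
  ext e'
  by_cases h : e' = e
  · subst h
    simp [mem_frac]
  · simp [mem_frac, h]

omit [DecidableEq E] in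
/-- A root edge is fractional. -/
lemma frac_of_mem_rootEdges {p : E → R} {ends : E → Sym2 V} {a₁ a₂ : V} {e : E}
    (he : e ∈ rootEdges p ends a₁ a₂) : e ∈ frac p :=
  (Finset.mem_filter.1 he).1

end Frac

/-! ## The base lemma: no fractional root edge ⟹ deterministic root clusters ⟹ `Gc = 0` -/

section Base

variable {V : Type*} {E : Type*} [Fintype E] [DecidableEq E] {R : Type*} [Field R]
  [LinearOrder R] [IsStrictOrderedRing R]

omit [DecidableEq E] in
/-- On the support of `p`, a non-fractional edge is open iff its weight is `1`. -/
lemma support_eq_oneConfig {p : E → R} {ω : Config E} (hω : weight p ω ≠ 0) {e : E}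
    (he : e ∉ frac p) : ω e = oneConfig p e := by
  have hfac : edgeFactor (p e) (ω e) ≠ 0 := by
    intro h0
    exact hω (Finset.prod_eq_zero (Finset.mem_univ e) h0)
  rw [mem_frac, not_and_or, not_not, not_not] at he
  unfold oneConfig
  rcases he with h0 | h1
  · rw [h0] at hfac
    cases hωe : ω e
    · simp [h0]
    · rw [hωe] at hfac
      simp at hfac
  · rw [h1] at hfac
    cases hωe : ω e
    · rw [hωe] at hfac
      simp at hfac
    · simp [h1]

variable {p : E → R} {ends : E → Sym2 V} {a₁ a₂ : V}

omit [DecidableEq E] in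
/-- With no fractional root edge, every configuration of the support agrees with `oneConfig p`
on the edges touching `S_l ∪ S_h`. -/
lemma support_eqOn_rootSet (h0 : rootEdges p ends a₁ a₂ = ∅) {ω : Config E}
    (hω : weight p ω ≠ 0) {e : E} (he : e ∈ touches ends (rootSet p ends a₁ a₂)) :
    oneConfig p e = ω e := by
  refine (support_eq_oneConfig hω fun hf => ?_).symm
  have : e ∈ rootEdges p ends a₁ a₂ := Finset.mem_filter.2 ⟨hf, he⟩
  rw [h0] at this
  exact Finset.notMem_empty e this

omit [DecidableEq E] in
/-- The red-root cluster is `S_l` on the support. -/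
lemma cluster_root₁_eq (h0 : rootEdges p ends a₁ a₂ = ∅) {ω : Config E}
    (hω : weight p ω ≠ 0) : cluster ends ω a₁ = cluster ends (oneConfig p) a₁ :=
  cluster_eq_of_eqOn_touches
    (fun e he => support_eqOn_rootSet h0 hω (by
      obtain ⟨x, hx, y, hxy⟩ := he
      exact ⟨x, Or.inl hx, y, hxy⟩)) rfl

omit [DecidableEq E] in
/-- The second root cluster is `S_h` on the support. -/
lemma cluster_root₂_eq (h0 : rootEdges p ends a₁ a₂ = ∅) {ω : Config E}
    (hω : weight p ω ≠ 0) : cluster ends ω a₂ = cluster ends (oneConfig p) a₂ :=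
  cluster_eq_of_eqOn_touches
    (fun e he => support_eqOn_rootSet h0 hω (by
      obtain ⟨x, hx, y, hxy⟩ := he
      exact ⟨x, Or.inr hx, y, hxy⟩)) rfl

/-- An event is *root-determined* if on the support it agrees with its value at `oneConfig p`. -/
def Det (p : E → R) (A : Set (Config E)) : Prop :=
  ∀ ω, weight p ω ≠ 0 → (ω ∈ A ↔ oneConfig p ∈ A)

omit [DecidableEq E] [IsStrictOrderedRing R] in
/-- Root-determined events are closed under intersection. -/
lemma Det.inter {A B : Set (Config E)} (hA : Det p A) (hB : Det p B) : Det p (A ∩ B) :=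
  fun ω hω => by rw [Set.mem_inter_iff, Set.mem_inter_iff, hA ω hω, hB ω hω]

omit [DecidableEq E] [IsStrictOrderedRing R] in
/-- Root-determined events are closed under union. -/
lemma Det.union {A B : Set (Config E)} (hA : Det p A) (hB : Det p B) : Det p (A ∪ B) :=
  fun ω hω => by rw [Set.mem_union, Set.mem_union, hA ω hω, hB ω hω]

omit [DecidableEq E] [IsStrictOrderedRing R] in
/-- Root-determined events are closed under complement. -/
lemma Det.compl {A : Set (Config E)} (hA : Det p A) : Det p Aᶜ :=
  fun ω hω => by rw [Set.mem_compl_iff, Set.mem_compl_iff, hA ω hω]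

omit [DecidableEq E] in
/-- Connections from the first root are root-determined. -/
lemma det_conn₁ (h0 : rootEdges p ends a₁ a₂ = ∅) (v : V) : Det p (connEvent ends a₁ v) := by
  intro ω hω
  simp only [connEvent, Set.mem_setOf_eq, ← mem_cluster, cluster_root₁_eq h0 hω]

omit [DecidableEq E] in
/-- Connections from the second root are root-determined. -/
lemma det_conn₂ (h0 : rootEdges p ends a₁ a₂ = ∅) (v : V) : Det p (connEvent ends a₂ v) := by
  intro ω hω
  simp only [connEvent, Set.mem_setOf_eq, ← mem_cluster, cluster_root₂_eq h0 hω]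

omit [DecidableEq E] in
/-- Connections to the first root are root-determined. -/
lemma det_conn₁' (h0 : rootEdges p ends a₁ a₂ = ∅) (v : V) : Det p (connEvent ends v a₁) := by
  intro ω hω
  have := det_conn₁ h0 v ω hω
  simp only [connEvent, Set.mem_setOf_eq] at this ⊢
  exact ⟨fun h => conn_symm (this.1 (conn_symm h)), fun h => conn_symm (this.2 (conn_symm h))⟩

omit [DecidableEq E] in
/-- Connections to the second root are root-determined. -/
lemma det_conn₂' (h0 : rootEdges p ends a₁ a₂ = ∅) (v : V) : Det p (connEvent ends v a₂) := by
  intro ω hω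
  have := det_conn₂ h0 v ω hω
  simp only [connEvent, Set.mem_setOf_eq] at this ⊢
  exact ⟨fun h => conn_symm (this.1 (conn_symm h)), fun h => conn_symm (this.2 (conn_symm h))⟩

omit [DecidableEq E] in
/-- `Q = {a₁ ↮ a₂}` is root-determined. -/
lemma det_avoidAll (h0 : rootEdges p ends a₁ a₂ = ∅) : Det p (avoidAll ends a₂ {a₁}) := by
  intro ω hω
  have := det_conn₂ h0 a₁ ω hω
  simp only [connEvent, Set.mem_setOf_eq] at this
  simp only [avoidAll, Set.mem_setOf_eq, Finset.mem_singleton, forall_eq, this]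

omit [DecidableEq E] in
/-- `PD` is root-determined. -/
lemma det_PDEvent (h0 : rootEdges p ends a₁ a₂ = ∅) (a₃ : V) : Det p (PDEvent ends a₁ a₂ a₃) :=
  (det_conn₁ h0 a₂).compl.inter ((det_conn₁' h0 a₃).union (det_conn₂' h0 a₃)).compl

omit [DecidableEq E] in
/-- `T` and `T′` are root-determined. -/
lemma det_TEvent (h0 : rootEdges p ends a₁ a₂ = ∅) (a₃ : V) :
    Det p (TEvent ends a₁ a₂ a₃) ∧ Det p (TEvent ends a₂ a₁ a₃) :=
  ⟨(det_conn₂ h0 a₁).compl.inter (det_conn₂ h0 a₃),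
    (det_conn₁ h0 a₂).compl.inter (det_conn₁ h0 a₃)⟩

omit [IsStrictOrderedRing R] in
/-- The probability of a root-determined event is its indicator at `oneConfig p`. -/
lemma prob_eq_ite_of_det {A : Set (Config E)} (hA : Det p A) :
    prob p A = if oneConfig p ∈ A then 1 else 0 := by
  unfold prob
  by_cases hmem : oneConfig p ∈ A
  · rw [if_pos hmem, ← sum_weight p]
    refine Finset.sum_congr rfl fun ω _ => ?_
    by_cases hω : weight p ω = 0
    · rw [hω, Set.indicator_apply_eq_zero.2 fun _ => hω]
    · exact Set.indicator_of_mem ((hA ω hω).2 hmem) _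
  · rw [if_neg hmem]
    refine Finset.sum_eq_zero fun ω _ => ?_
    by_cases hω : weight p ω = 0
    · rw [Set.indicator_apply_eq_zero.2 fun _ => hω]
    · exact Set.indicator_of_notMem (fun h => hmem ((hA ω hω).1 h)) _

/-- **The base lemma** (mine-a's `pinnedClusters_Gc_eq_zero`): with no fractional root edge,
`Gc = 0`. -/
theorem Gc_eq_zero_of_rootEdges_empty (h0 : rootEdges p ends a₁ a₂ = ∅)
    (o a₃ b : V) : Gc p ends o a₁ a₂ a₃ b = 0 := by
  have hQ := det_avoidAll h0
  have hPD := det_PDEvent h0 a₃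
  obtain ⟨hT, hT'⟩ := det_TEvent h0 a₃
  have hc₁ := det_conn₁ h0
  have hc₂ := det_conn₂ h0
  unfold Gc DEF EQbo EQb3 EQb3o EQo EQ3 EQ3o PDb PDbo Do gap
  simp only [prob_eq_ite_of_det hQ, prob_eq_ite_of_det hPD, prob_eq_ite_of_det hT,
    prob_eq_ite_of_det hT',
    prob_eq_ite_of_det (hQ.inter ((hc₁ o).inter (hc₁ b))),
    prob_eq_ite_of_det (hQ.inter ((hc₂ o).inter (hc₂ b))),
    prob_eq_ite_of_det (hQ.inter ((hc₂ o).inter (hc₁ b))),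
    prob_eq_ite_of_det (hQ.inter ((hc₁ o).inter (hc₂ b))),
    prob_eq_ite_of_det (hT'.inter (hc₁ b)), prob_eq_ite_of_det (hT.inter (hc₂ b)),
    prob_eq_ite_of_det (hT.inter (hc₁ b)), prob_eq_ite_of_det (hT'.inter (hc₂ b)),
    prob_eq_ite_of_det (hT'.inter ((hc₁ o).inter (hc₁ b))),
    prob_eq_ite_of_det (hT'.inter ((hc₂ o).inter (hc₁ b))),
    prob_eq_ite_of_det (hT.inter ((hc₁ o).inter (hc₂ b))),
    prob_eq_ite_of_det (hT.inter ((hc₂ o).inter (hc₂ b))),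
    prob_eq_ite_of_det (hT.inter ((hc₁ o).inter (hc₁ b))),
    prob_eq_ite_of_det (hT.inter ((hc₂ o).inter (hc₁ b))),
    prob_eq_ite_of_det (hT'.inter ((hc₁ o).inter (hc₂ b))),
    prob_eq_ite_of_det (hT'.inter ((hc₂ o).inter (hc₂ b))),
    prob_eq_ite_of_det (hQ.inter (hc₁ o)), prob_eq_ite_of_det (hQ.inter (hc₂ o)),
    prob_eq_ite_of_det (hT'.inter (hc₁ o)), prob_eq_ite_of_det (hT'.inter (hc₂ o)),
    prob_eq_ite_of_det (hT.inter (hc₁ o)), prob_eq_ite_of_det (hT.inter (hc₂ o)),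
    prob_eq_ite_of_det (hPD.inter (hc₁ b)), prob_eq_ite_of_det (hPD.inter (hc₂ b)),
    prob_eq_ite_of_det (hPD.inter ((hc₁ o).inter (hc₁ b))),
    prob_eq_ite_of_det (hPD.inter ((hc₂ o).inter (hc₁ b))),
    prob_eq_ite_of_det (hPD.inter ((hc₁ o).inter (hc₂ b))),
    prob_eq_ite_of_det (hPD.inter ((hc₂ o).inter (hc₂ b))),
    prob_eq_ite_of_det (hPD.inter (hc₁ o)), prob_eq_ite_of_det (hPD.inter (hc₂ o)),
    prob_eq_ite_of_det (hc₂ b), prob_eq_ite_of_det (hc₁ b)]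
  -- the seven atoms at `oneConfig p`
  set ω₁ := oneConfig p
  have h21 : Conn ends ω₁ a₂ a₁ ↔ Conn ends ω₁ a₁ a₂ := ⟨conn_symm, conn_symm⟩
  have h31 : Conn ends ω₁ a₃ a₁ ↔ Conn ends ω₁ a₁ a₃ := ⟨conn_symm, conn_symm⟩
  have h32 : Conn ends ω₁ a₃ a₂ ↔ Conn ends ω₁ a₂ a₃ := ⟨conn_symm, conn_symm⟩
  simp only [Set.mem_inter_iff, Set.mem_compl_iff, Set.mem_union, avoidAll, PDEvent, TEvent,
    Dtilde, inU, connEvent, Set.mem_setOf_eq, Finset.mem_singleton, forall_eq, h21, h31, h32]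
  by_cases x12 : Conn ends ω₁ a₁ a₂ <;> by_cases x1o : Conn ends ω₁ a₁ o <;>
    by_cases x2o : Conn ends ω₁ a₂ o <;> by_cases x1b : Conn ends ω₁ a₁ b <;>
    by_cases x2b : Conn ends ω₁ a₂ b <;> by_cases x13 : Conn ends ω₁ a₁ a₃ <;>
    by_cases x23 : Conn ends ω₁ a₂ a₃ <;> norm_num [x12, x1o, x2o, x1b, x2b, x13, x23]

end Base

end Chord

end Summit.Ventures.PercRepro2
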